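import Mathlib
import HarnessLib
import Summits.HubbardSuperconductivity.HubbardSuperconductivity.Theorems.KLProgrammeKLRegimeCountertermJacksonKernel

/-!
# Route `KLProgramme`, crux K3 — gen-8 ENGINE-FLOW child (stmt-HubbardSuperconductivity-20437 `KLRegimeEngineV17F2`), stub (C)
# `stub_twoLeg_curvature`, door (C1) «Jackson remainder»: SHARP constants for the `2π`-periodic Jackson kernel

Seat hubbard-kl-k3c3-p1 (g5).  The (C1) part of the cumulative-reading decomposition (c4a-1, KL STATUS 2026-08-27 l.2674/2731; k3c3-p3 l.2729) is the
remainder `f − (𝒥_d E_μ f)∘γ` of the previous reading under the Jackson mean of degree `d = klFlowDeg n`; whether the degree schedule fits the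
two-leg tables is decided by the kernel's first/second moments and its tail.  The tree's constants (`…JacksonFrameBounds` `π⁶/(2(d+1))`,
`…JacksonSecondOrder` `π⁷/(d+1)²`, `jackson_le_inv` `π⁴/128`) come from the peak lower bound `c_M ≥ 8(M+1)/π⁴` of the normaliser and are
≈ 360× / 1000× / 8× above the truth (`≈ 1.32/(d+1)`, `≈ 3.0/(d+1)²`, `≈ 0.094`).  This file proves the sharp(er) ones:

* §1 PARSEVAL for the Fejér kernel: `integral_cos_mul_cos_two_pi` (orthogonality), **`jacksonConst_eq`** (`c_M = 1 + (2/(M+1)²)·Σ_{h=1}^{M}(M+1−h)²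
  = 1 + M(2M+1)/(3(M+1))`), **`jacksonConst_ge_sharp`** (`c_M ≥ 2(M+1)/3`);
* §2 pointwise: `sq_mul_fejer_le` (`x²F_M ≤ 1/(4(M+1))`), `abs_mul_fejer_le` (`|x|F_M ≤ ½`), `jackson_le_lin` (`J_M ≤ 3(M+1)/2`),
  `abs_mul_jackson_le_fejer` (`|x|J_M ≤ 3F_M/(4(M+1))`), `sq_mul_jackson_le_fejer` (`x²J_M ≤ 3F_M/(8(M+1)²)`), `jackson_le_inv_sharp`
  (`J_M ≤ 3/(32(M+1)³x⁴)`);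
* §3 in the `2π`-periodic variable (`jker d s = J_d(s/2π)/(2π)` of `…CountertermJacksonKernel`): **`integral_abs_mul_jker_le_sharp`**
  (`∫_{−π}^{π}|s|J̃_d ≤ 3π/(2(d+1))`), **`integral_sq_mul_jker_le_sharp`** (`∫ s²J̃_d ≤ 3π²/(2(d+1)²)`), **`integral_jker_tail_le`**
  (`∫_δ^π J̃_d ≤ π³/(4((d+1)δ)³)`, `0 < δ ≤ π`).

Pure real analysis; nothing about the model; nothing here asserts superconductivity.  References: DeVore–Lorentz, Constructive Approximation, Ch. 7 §2;
Travaglini 2014 §7.1 (7.3).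
-/

noncomputable section

namespace Summit.HubbardSuperconductivity.HubbardSuperconductivity.Theorems.KLRegimeSplit

set_option linter.dupNamespace false -- summit = problem name (single-conjunct summit), D-0017

open Real Finset MeasureTheory intervalIntegral
open Literature.Analysis.Fourier.TrigApprox

/-! ## §1 Parseval for the Fejér kernel -/

/-- **Orthogonality**: `∫₀¹ cos(2πhx)·cos(2πkx) dx = ½·[h = k]` for `h, k ≥ 1`. -/
theorem integral_cos_mul_cos_two_pi {h k : ℕ} (hh : 1 ≤ h) (hk : 1 ≤ k) :
    ∫ x in (0 : ℝ)..1, Real.cos (2 * π * h * x) * Real.cos (2 * π * k * x) = if h = k then 1 / 2 else 0 := by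
  have hprod : ∀ x : ℝ, Real.cos (2 * π * h * x) * Real.cos (2 * π * k * x) =
      (Real.cos (2 * π * h * x - 2 * π * k * x) + Real.cos (2 * π * h * x + 2 * π * k * x)) / 2 := by
    intro x; rw [Real.cos_sub, Real.cos_add]; ring
  simp_rw [hprod]
  rw [intervalIntegral.integral_div, intervalIntegral.integral_add ((by fun_prop : Continuous _).intervalIntegrable _ _)
    ((by fun_prop : Continuous _).intervalIntegrable _ _)]
  have hsum : ∫ x in (0 : ℝ)..1, Real.cos (2 * π * h * x + 2 * π * k * x) = 0 := by
    have e : (fun x : ℝ => Real.cos (2 * π * h * x + 2 * π * k * x)) = fun x => Real.cos (2 * π * ((h + k : ℕ) : ℝ) * x) := by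
      funext x; push_cast; ring_nf
    rw [e]; exact integral_cos_two_pi_mul_nat (by omega)
  split_ifs with heq
  · subst heq
    have h0 : ∫ x in (0 : ℝ)..1, Real.cos (2 * π * h * x - 2 * π * h * x) = 1 := by simp
    rw [h0, hsum]; norm_num
  · have hdiff : ∫ x in (0 : ℝ)..1, Real.cos (2 * π * h * x - 2 * π * k * x) = 0 := by
      rcases Nat.lt_or_gt_of_ne heq with hlt | hgt
      · obtain ⟨m, rfl⟩ := Nat.exists_eq_add_of_lt hlt
        have e : (fun x : ℝ => Real.cos (2 * π * h * x - 2 * π * ((h + m + 1 : ℕ) : ℝ) * x)) =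
            fun x => Real.cos (2 * π * ((m + 1 : ℕ) : ℝ) * x) := by
          funext x; rw [← Real.cos_neg]; push_cast; ring_nf
        rw [e]; exact integral_cos_two_pi_mul_nat (by omega)
      · obtain ⟨m, rfl⟩ := Nat.exists_eq_add_of_lt hgt
        have e : (fun x : ℝ => Real.cos (2 * π * ((k + m + 1 : ℕ) : ℝ) * x - 2 * π * k * x)) =
            fun x => Real.cos (2 * π * ((m + 1 : ℕ) : ℝ) * x) := by
          funext x; push_cast; ring_nf
        rw [e]; exact integral_cos_two_pi_mul_nat (by omega)
    rw [hdiff, hsum]; norm_num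

/-- `Σ_{i<M} (i+1)² = M(M+1)(2M+1)/6`. -/
theorem sum_range_succ_sq (M : ℕ) : ∑ i ∈ Finset.range M, ((i : ℝ) + 1) ^ 2 = (M : ℝ) * (M + 1) * (2 * M + 1) / 6 := by
  induction M with
  | zero => simp
  | succ M ih => rw [Finset.sum_range_succ, ih]; push_cast; ring

/-- `Σ_{h=1}^{M} (M+1−h)² = M(M+1)(2M+1)/6`. -/
theorem sum_Icc_sub_sq (M : ℕ) : ∑ h ∈ Finset.Icc 1 M, ((M + 1 : ℝ) - h) ^ 2 = (M : ℝ) * (M + 1) * (2 * M + 1) / 6 := by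
  rw [← sum_range_succ_sq]
  refine Finset.sum_nbij' (fun h => M - h) (fun i => M - i) ?_ ?_ ?_ ?_ ?_
  · intro a ha; simp only [Finset.mem_Icc] at ha; simp only [Finset.mem_range]; omega
  · intro a ha; simp only [Finset.mem_range] at ha; simp only [Finset.mem_Icc]; omega
  · intro a ha; simp only [Finset.mem_Icc] at ha; omega
  · intro a ha; simp only [Finset.mem_range] at ha; omega
  · intro a ha; simp only [Finset.mem_Icc] at ha
    rw [Nat.cast_sub ha.2]; ring

/-- **Parseval for the Fejér kernel**: `c_M = ∫₀¹F_M² = 1 + (2/(M+1)²)·Σ_{h=1}^{M}(M+1−h)²`. -/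
theorem jacksonConst_eq (M : ℕ) :
    jacksonConst M = 1 + 2 / (M + 1) ^ 2 * ∑ h ∈ Finset.Icc 1 M, ((M + 1 : ℝ) - h) ^ 2 := by
  unfold jacksonConst
  have hM : (M + 1 : ℝ) ≠ 0 := by positivity
  set c : ℝ := 2 / (M + 1) with hc
  set S : ℝ → ℝ := fun x => ∑ h ∈ Finset.Icc 1 M, ((M + 1 : ℝ) - h) * Real.cos (2 * π * h * x) with hS
  have hF : ∀ x, fejer M x = 1 + c * S x := fun x => fejer_eq M x
  have hS_cont : Continuous S := continuous_finsetSum _ fun h _ => by fun_prop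
  -- `∫ S = 0`
  have hS_int : ∫ x in (0 : ℝ)..1, S x = 0 := by
    rw [intervalIntegral.integral_finsetSum]
    · refine Finset.sum_eq_zero fun h hh => ?_
      rw [intervalIntegral.integral_const_mul, integral_cos_two_pi_mul_nat (Finset.mem_Icc.mp hh).1, mul_zero]
    · intro h _; exact (by fun_prop : Continuous _).intervalIntegrable _ _
  -- `∫ S² = ½ Σ w_h²`
  have hS2_int : ∫ x in (0 : ℝ)..1, S x ^ 2 = 1 / 2 * ∑ h ∈ Finset.Icc 1 M, ((M + 1 : ℝ) - h) ^ 2 := by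
    have hexp : ∀ x, S x ^ 2 = ∑ h ∈ Finset.Icc 1 M, ∑ k ∈ Finset.Icc 1 M,
        (((M + 1 : ℝ) - h) * ((M + 1 : ℝ) - k)) * (Real.cos (2 * π * h * x) * Real.cos (2 * π * k * x)) := by
      intro x; rw [sq, hS, Finset.sum_mul_sum]
      exact Finset.sum_congr rfl fun h _ => Finset.sum_congr rfl fun k _ => by ring
    simp_rw [hexp]
    rw [intervalIntegral.integral_finsetSum]
    · have inner : ∀ h ∈ Finset.Icc 1 M, ∫ x in (0 : ℝ)..1, ∑ k ∈ Finset.Icc 1 M,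
          (((M + 1 : ℝ) - h) * ((M + 1 : ℝ) - k)) * (Real.cos (2 * π * h * x) * Real.cos (2 * π * k * x)) =
          1 / 2 * ((M + 1 : ℝ) - h) ^ 2 := by
        intro h hh
        rw [intervalIntegral.integral_finsetSum]
        · have e : ∀ k ∈ Finset.Icc 1 M, ∫ x in (0 : ℝ)..1, (((M + 1 : ℝ) - h) * ((M + 1 : ℝ) - k)) *
              (Real.cos (2 * π * h * x) * Real.cos (2 * π * k * x)) =
              (((M + 1 : ℝ) - h) * ((M + 1 : ℝ) - k)) * (if h = k then 1 / 2 else 0) := by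
            intro k hk
            rw [intervalIntegral.integral_const_mul,
              integral_cos_mul_cos_two_pi (Finset.mem_Icc.mp hh).1 (Finset.mem_Icc.mp hk).1]
          rw [Finset.sum_congr rfl e]
          simp_rw [mul_ite, mul_zero]
          rw [Finset.sum_ite_eq, if_pos hh]; ring
        · intro k _; exact (by fun_prop : Continuous _).intervalIntegrable _ _
      rw [Finset.sum_congr rfl inner, ← Finset.mul_sum]
    · intro h _; exact (continuous_finsetSum _ fun k _ => by fun_prop).intervalIntegrable _ _
  have hF2 : (fun x => fejer M x ^ 2) = fun x => (1 + 2 * c * S x) + c ^ 2 * S x ^ 2 := by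
    funext x; rw [hF]; ring
  have hI1 : IntervalIntegrable (fun x => 1 + 2 * c * S x) volume 0 1 :=
    (by fun_prop : Continuous fun x => 1 + 2 * c * S x).intervalIntegrable _ _
  have hI2 : IntervalIntegrable (fun x => c ^ 2 * S x ^ 2) volume 0 1 :=
    (by fun_prop : Continuous fun x => c ^ 2 * S x ^ 2).intervalIntegrable _ _
  have hI3 : IntervalIntegrable (fun x => 2 * c * S x) volume 0 1 :=
    (by fun_prop : Continuous fun x => 2 * c * S x).intervalIntegrable _ _
  have hI0 : IntervalIntegrable (fun _ : ℝ => (1 : ℝ)) volume 0 1 := intervalIntegrable_const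
  rw [hF2, intervalIntegral.integral_add hI1 hI2, intervalIntegral.integral_add hI0 hI3,
    intervalIntegral.integral_const_mul, intervalIntegral.integral_const_mul, hS_int, hS2_int,
    intervalIntegral.integral_const]
  simp only [sub_zero, smul_eq_mul, mul_one, mul_zero, add_zero]
  rw [hc]
  field_simp

/-- **`c_M ≥ 2(M+1)/3`** (sharp up to `1/(3(M+1))`; the tree's `jacksonConst_ge` is `8(M+1)/π⁴`). -/
theorem jacksonConst_ge_sharp (M : ℕ) : 2 * (M + 1) / 3 ≤ jacksonConst M := by
  rw [jacksonConst_eq, sum_Icc_sub_sq]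
  have hM : (0 : ℝ) < M + 1 := by positivity
  rw [div_le_iff₀ (by norm_num : (0 : ℝ) < 3)]
  have e : (1 + 2 / (M + 1 : ℝ) ^ 2 * ((M : ℝ) * (M + 1) * (2 * M + 1) / 6)) * 3 = 3 + M * (2 * M + 1) / (M + 1) := by
    field_simp; ring
  rw [e, ← sub_nonneg]
  have e2 : 3 + (M : ℝ) * (2 * M + 1) / (M + 1) - 2 * (M + 1) = 1 / (M + 1) := by field_simp; ring
  rw [e2]; positivity

/-! ## §2 Pointwise bounds -/

/-- `x²·F_M(x) ≤ 1/(4(M+1))` on `|x| ≤ 1/2`. -/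
theorem sq_mul_fejer_le (M : ℕ) {x : ℝ} (hx : |x| ≤ 1 / 2) : x ^ 2 * fejer M x ≤ 1 / (4 * (M + 1)) := by
  rcases eq_or_ne x 0 with rfl | hx0
  · simp only [ne_eq, OfNat.ofNat_ne_zero, not_false_eq_true, zero_pow, zero_mul]; positivity
  have h := fejer_le_inv M hx0 hx
  have hx2 : 0 < x ^ 2 := by positivity
  calc x ^ 2 * fejer M x ≤ x ^ 2 * (1 / (4 * (M + 1) * x ^ 2)) := mul_le_mul_of_nonneg_left h hx2.le
    _ = 1 / (4 * (M + 1)) := by field_simp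

/-- `|x|·F_M(x) ≤ 1/2` on `|x| ≤ 1/2` (peak bound below `1/(2(M+1))`, tail bound above). -/
theorem abs_mul_fejer_le (M : ℕ) {x : ℝ} (hx : |x| ≤ 1 / 2) : |x| * fejer M x ≤ 1 / 2 := by
  have hM : (0 : ℝ) < M + 1 := by positivity
  have hF0 := fejer_nonneg M x
  rcases le_or_gt |x| (1 / (2 * (M + 1))) with hs | hl
  · calc |x| * fejer M x ≤ (1 / (2 * (M + 1))) * (M + 1) := mul_le_mul hs (fejer_le M x) hF0 (by positivity)
      _ = 1 / 2 := by field_simp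
  · have hxpos : 0 < |x| := lt_trans (by positivity) hl
    have hx0 : x ≠ 0 := abs_pos.mp hxpos
    have h := fejer_le_inv M hx0 hx
    have hx2 : x ^ 2 = |x| ^ 2 := (sq_abs x).symm
    have hl' : 1 < 2 * (M + 1) * |x| := by
      rw [div_lt_iff₀ (by positivity)] at hl; linarith
    calc |x| * fejer M x ≤ |x| * (1 / (4 * (M + 1) * x ^ 2)) := mul_le_mul_of_nonneg_left h hxpos.le
      _ = 1 / (4 * (M + 1) * |x|) := by rw [hx2]; field_simp
      _ ≤ 1 / 2 := by
          rw [div_le_div_iff₀ (by positivity) (by norm_num)]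
          linarith

/-- **`J_M ≤ (3/2)(M+1)`** (from `F ≤ M+1`, `c_M ≥ 2(M+1)/3`). -/
theorem jackson_le_lin (M : ℕ) (x : ℝ) : jackson M x ≤ 3 / 2 * (M + 1) := by
  unfold jackson
  have hc := jacksonConst_ge_sharp M
  have hcpos := jacksonConst_pos M
  have hF := fejer_le M x
  have hF0 := fejer_nonneg M x
  rw [div_le_iff₀ hcpos]
  have h1 : fejer M x ^ 2 ≤ (M + 1 : ℝ) ^ 2 := pow_le_pow_left₀ hF0 hF 2
  calc fejer M x ^ 2 ≤ (M + 1 : ℝ) ^ 2 := h1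
    _ = 3 / 2 * (M + 1) * (2 * (M + 1) / 3) := by field_simp
    _ ≤ 3 / 2 * (M + 1) * jacksonConst M := by gcongr

/-- **`|x|·J_M(x) ≤ (3/(4(M+1)))·F_M(x)`** on `|x| ≤ 1/2`. -/
theorem abs_mul_jackson_le_fejer (M : ℕ) {x : ℝ} (hx : |x| ≤ 1 / 2) :
    |x| * jackson M x ≤ 3 / (4 * (M + 1)) * fejer M x := by
  unfold jackson
  have hM : (0 : ℝ) < M + 1 := by positivity
  have hc := jacksonConst_ge_sharp M
  have hcpos := jacksonConst_pos M
  have h1 := abs_mul_fejer_le M hx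
  have hF0 := fejer_nonneg M x
  calc |x| * (fejer M x ^ 2 / jacksonConst M) = (|x| * fejer M x) * fejer M x / jacksonConst M := by ring
    _ ≤ (1 / 2) * fejer M x / jacksonConst M := by gcongr
    _ ≤ (1 / 2) * fejer M x / (2 * (M + 1) / 3) := by
        apply div_le_div_of_nonneg_left _ (by positivity) hc; positivity
    _ = 3 / (4 * (M + 1)) * fejer M x := by field_simp; ring

/-- **`x²·J_M(x) ≤ (3/(8(M+1)²))·F_M(x)`** on `|x| ≤ 1/2`. -/
theorem sq_mul_jackson_le_fejer (M : ℕ) {x : ℝ} (hx : |x| ≤ 1 / 2) :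
    x ^ 2 * jackson M x ≤ 3 / (8 * (M + 1) ^ 2) * fejer M x := by
  unfold jackson
  have hM : (0 : ℝ) < M + 1 := by positivity
  have hc := jacksonConst_ge_sharp M
  have hcpos := jacksonConst_pos M
  have h1 := sq_mul_fejer_le M hx
  have hF0 := fejer_nonneg M x
  calc x ^ 2 * (fejer M x ^ 2 / jacksonConst M) = (x ^ 2 * fejer M x) * fejer M x / jacksonConst M := by ring
    _ ≤ (1 / (4 * (M + 1))) * fejer M x / jacksonConst M := by gcongr
    _ ≤ (1 / (4 * (M + 1))) * fejer M x / (2 * (M + 1) / 3) := by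
        apply div_le_div_of_nonneg_left _ (by positivity) hc; positivity
    _ = 3 / (8 * (M + 1) ^ 2) * fejer M x := by field_simp; ring

/-- **Sharp tail**: `J_M(x) ≤ 3/(32(M+1)³x⁴)` for `0 < |x| ≤ 1/2` (the tree's `jackson_le_inv` has `π⁴/128`). -/
theorem jackson_le_inv_sharp (M : ℕ) {x : ℝ} (hx0 : x ≠ 0) (hx : |x| ≤ 1 / 2) :
    jackson M x ≤ 3 / (32 * (M + 1) ^ 3 * x ^ 4) := by
  have hM : (0 : ℝ) < M + 1 := by positivity
  have hc := jacksonConst_ge_sharp M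
  have hc0 := jacksonConst_pos M
  have hF := fejer_le_inv M hx0 hx
  have hF0 := fejer_nonneg M x
  have hx2 : 0 < x ^ 2 := by positivity
  unfold jackson
  have h1 : fejer M x ^ 2 ≤ (1 / (4 * (M + 1) * x ^ 2)) ^ 2 := pow_le_pow_left₀ hF0 hF 2
  calc fejer M x ^ 2 / jacksonConst M ≤ (1 / (4 * (M + 1) * x ^ 2)) ^ 2 / (2 * (M + 1) / 3) := by
        gcongr
    _ = 3 / (32 * (M + 1) ^ 3 * x ^ 4) := by field_simp; ring

/-! ## §3 Moments and tail of the `2π`-periodic kernel `jker` -/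

/-- `∫_{−1/2}^{1/2} F_M = 1` (periodicity). -/
theorem integral_fejer_symm (M : ℕ) : ∫ x in (-(1 / 2 : ℝ))..(1 / 2), fejer M x = 1 := by
  have hper : Function.Periodic (fejer M) 1 := fun x => fejer_add_one M x
  have h := hper.intervalIntegral_add_eq (-(1 / 2 : ℝ)) 0
  rw [zero_add, integral_fejer] at h
  have e : (-(1 / 2 : ℝ) + 1) = 1 / 2 := by norm_num
  rw [e] at h
  exact h

/-- **Sharp first absolute moment**: `∫_{−π}^{π} |s|·J̃_d(s) ds ≤ 3π/(2(d+1))`. -/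
theorem integral_abs_mul_jker_le_sharp (d : ℕ) : ∫ s in (-π)..π, |s| * jker d s ≤ 3 * π / (2 * (d + 1)) := by
  have h2π : (2 * π : ℝ) ≠ 0 := by positivity
  have h2πpos : (0 : ℝ) < 2 * π := by positivity
  have hd : (0 : ℝ) < d + 1 := by positivity
  have hsub : ∫ s in (-π)..π, |s| * jker d s = (2 * π) * ∫ x in (-(1 / 2 : ℝ))..(1 / 2), |x| * jackson d x := by
    have hpt : ∀ s, |s| * jker d s = (fun x => |x| * jackson d x) (s / (2 * π)) := by
      intro s
      simp only [jker, abs_div, abs_of_pos h2πpos]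
      field_simp
    rw [intervalIntegral.integral_congr fun s _ => hpt s, intervalIntegral.integral_comp_div (fun x => |x| * jackson d x) h2π,
      show -π / (2 * π) = -(1 / 2 : ℝ) by field_simp, show π / (2 * π) = (1 / 2 : ℝ) by field_simp, smul_eq_mul]
  rw [hsub]
  have hmaj : ∫ x in (-(1 / 2 : ℝ))..(1 / 2), |x| * jackson d x ≤ ∫ x in (-(1 / 2 : ℝ))..(1 / 2), 3 / (4 * (d + 1)) * fejer d x := by
    refine intervalIntegral.integral_mono_on (by norm_num)
      ((continuous_abs.mul (continuous_jackson d)).intervalIntegrable _ _)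
      ((continuous_const.mul (continuous_fejer d)).intervalIntegrable _ _) fun x hx => abs_mul_jackson_le_fejer d ?_
    rw [abs_le]; exact ⟨by linarith [hx.1], by linarith [hx.2]⟩
  rw [intervalIntegral.integral_const_mul, integral_fejer_symm, mul_one] at hmaj
  calc (2 * π) * ∫ x in (-(1 / 2 : ℝ))..(1 / 2), |x| * jackson d x ≤ (2 * π) * (3 / (4 * (d + 1))) :=
        mul_le_mul_of_nonneg_left hmaj (by positivity)
    _ = 3 * π / (2 * (d + 1)) := by field_simp; ring

/-- **Sharp second moment**: `∫_{−π}^{π} s²·J̃_d(s) ds ≤ 3π²/(2(d+1)²)`. -/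
theorem integral_sq_mul_jker_le_sharp (d : ℕ) : ∫ s in (-π)..π, s ^ 2 * jker d s ≤ 3 * π ^ 2 / (2 * (d + 1) ^ 2) := by
  have h2π : (2 * π : ℝ) ≠ 0 := by positivity
  have hd : (0 : ℝ) < d + 1 := by positivity
  have hsub : ∫ s in (-π)..π, s ^ 2 * jker d s = (2 * π) ^ 2 * ∫ x in (-(1 / 2 : ℝ))..(1 / 2), x ^ 2 * jackson d x := by
    have hpt : ∀ s, s ^ 2 * jker d s = (2 * π) * (fun x => x ^ 2 * jackson d x) (s / (2 * π)) := by
      intro s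
      simp only [jker]
      field_simp
    rw [intervalIntegral.integral_congr fun s _ => hpt s, intervalIntegral.integral_const_mul,
      intervalIntegral.integral_comp_div (fun x => x ^ 2 * jackson d x) h2π,
      show -π / (2 * π) = -(1 / 2 : ℝ) by field_simp, show π / (2 * π) = (1 / 2 : ℝ) by field_simp, smul_eq_mul]
    ring
  rw [hsub]
  have hmaj : ∫ x in (-(1 / 2 : ℝ))..(1 / 2), x ^ 2 * jackson d x ≤ ∫ x in (-(1 / 2 : ℝ))..(1 / 2), 3 / (8 * (d + 1) ^ 2) * fejer d x := by
    refine intervalIntegral.integral_mono_on (by norm_num)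
      (((continuous_pow 2).mul (continuous_jackson d)).intervalIntegrable _ _)
      ((continuous_const.mul (continuous_fejer d)).intervalIntegrable _ _) fun x hx => sq_mul_jackson_le_fejer d ?_
    rw [abs_le]; exact ⟨by linarith [hx.1], by linarith [hx.2]⟩
  rw [intervalIntegral.integral_const_mul, integral_fejer_symm, mul_one] at hmaj
  calc (2 * π) ^ 2 * ∫ x in (-(1 / 2 : ℝ))..(1 / 2), x ^ 2 * jackson d x ≤ (2 * π) ^ 2 * (3 / (8 * (d + 1) ^ 2)) :=
        mul_le_mul_of_nonneg_left hmaj (by positivity)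
    _ = 3 * π ^ 2 / (2 * (d + 1) ^ 2) := by field_simp; ring

/-- **Cubic tail**: `∫_δ^π J̃_d(s) ds ≤ π³/(4((d+1)δ)³)` for `0 < δ ≤ π` (both tails: `π³/(2((d+1)δ)³)` by evenness). -/
theorem integral_jker_tail_le (d : ℕ) {δ : ℝ} (hδ : 0 < δ) (hδπ : δ ≤ π) :
    ∫ s in δ..π, jker d s ≤ π ^ 3 / (4 * ((d + 1) * δ) ^ 3) := by
  have h2π : (2 * π : ℝ) ≠ 0 := by positivity
  have h2πpos : (0 : ℝ) < 2 * π := by positivity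
  have hd : (0 : ℝ) < d + 1 := by positivity
  set a : ℝ := δ / (2 * π) with ha
  have ha0 : 0 < a := by positivity
  have ha1 : a ≤ 1 / 2 := by rw [ha, div_le_iff₀ h2πpos]; linarith
  have hsub : ∫ s in δ..π, jker d s = ∫ x in a..(1 / 2), jackson d x := by
    unfold jker
    rw [intervalIntegral.integral_div, intervalIntegral.integral_comp_div (fun x => jackson d x) h2π,
      show π / (2 * π) = (1 / 2 : ℝ) by field_simp, smul_eq_mul, ← ha]
    field_simp
  rw [hsub]
  have hmaj : ∫ x in a..(1 / 2), jackson d x ≤ ∫ x in a..(1 / 2), 3 / (32 * (d + 1) ^ 3) * x ^ (-4 : ℤ) := by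
    refine intervalIntegral.integral_mono_on ha1 ((continuous_jackson d).intervalIntegrable _ _) ?_ fun x hx => ?_
    · refine (ContinuousOn.intervalIntegrable ?_)
      refine continuousOn_const.mul (ContinuousOn.zpow₀ continuousOn_id _ ?_)
      intro x hx
      rw [Set.uIcc_of_le ha1] at hx
      left; exact (lt_of_lt_of_le ha0 hx.1).ne'
    · have hx0 : 0 < x := lt_of_lt_of_le ha0 hx.1
      have hxabs : |x| ≤ 1 / 2 := by rw [abs_of_pos hx0]; exact hx.2
      have h := jackson_le_inv_sharp d hx0.ne' hxabs
      calc jackson d x ≤ 3 / (32 * (d + 1) ^ 3 * x ^ 4) := h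
        _ = 3 / (32 * (d + 1) ^ 3) * x ^ (-4 : ℤ) := by
            rw [zpow_neg, zpow_ofNat]; field_simp
  refine hmaj.trans ?_
  rw [intervalIntegral.integral_const_mul, integral_zpow (Or.inr ⟨by norm_num, ?_⟩)]
  · have e1 : ((-4 : ℤ) + 1) = -3 := by norm_num
    rw [e1]
    have hhalf : (0 : ℝ) ≤ (1 / 2 : ℝ) ^ (-3 : ℤ) := zpow_nonneg (by norm_num) _
    have ha3 : a ^ (-3 : ℤ) = 1 / a ^ 3 := by rw [zpow_neg, zpow_ofNat, one_div]
    calc 3 / (32 * (d + 1 : ℝ) ^ 3) * (((1 / 2 : ℝ) ^ (-3 : ℤ) - a ^ (-3 : ℤ)) / (((-4 : ℤ) : ℝ) + 1))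
        = 1 / (32 * (d + 1 : ℝ) ^ 3) * (a ^ (-3 : ℤ) - (1 / 2 : ℝ) ^ (-3 : ℤ)) := by push_cast; ring
      _ ≤ 1 / (32 * (d + 1 : ℝ) ^ 3) * a ^ (-3 : ℤ) := by
          apply mul_le_mul_of_nonneg_left _ (by positivity); linarith
      _ = π ^ 3 / (4 * ((d + 1) * δ) ^ 3) := by
          rw [ha3, ha]; field_simp; ring
  · rw [Set.uIcc_of_le ha1]
    intro h0; exact absurd h0.1 (not_le.mpr ha0)

end Summit.HubbardSuperconductivity.HubbardSuperconductivity.Theorems.KLRegimeSplit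

end
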